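import Mathlib
import HarnessLib

/-!
# Input (Λ3c) of the `Λ`-adic road to SURJ⁺@2 (item 23110), pure-algebra half: the RANK of a lattice of classes is bounded by
# the `p`-TORSION of the discrete group it reduces into — Artin–Rees for finitely generated free lattices in a separated
# torsion-free `ℤ_p`-module (compactness of `ℤ_p^m`), torsion growth `#A[p^k] ≤ #A[p]^k`, and the counting

Routes `ResidualThetaTransportAtTwo` (RTT, crux r201 `ResidualLambdaFormulaNegDiscAtTwo`, stmt-BirchSwinnertonDyer-23110) /
`ThetaPartnerAtTwo` (K1 `stub_surj2`). Seat `prover-bsd-wall-tp2-p2x-w2` g14; `--supports stmt-BirchSwinnertonDyer-23110`.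
THEOREMS ONLY, PURE ALGEBRA / TOPOLOGY OF `ℤ_p^m` (no definition, no named fact, no `sorry`); nothing about Selmer groups is
asserted here.

WHY. The engine of the road (`…UniversalNormTowerVanishing` p653237, `…UniversalNormMittagLeffler` p654128, this seat) displays
ONE arithmetic input besides finiteness/stability of the level groups `C n k ≤ H¹(ℚ_n, E[p^k])`: the RANK BOUND «every
`ℤ_p`-linearly independent family `y_1, …, y_m ∈ H¹(ℚ_n, T_pE)` whose reductions lie in the `C n k` has `m ≤ B`», uniformly in
`n` ((Λ3) in compact form). For level groups pulled back from a FIXED discrete group `A = Sel⁺(E/ℚ_∞) ≤ H¹(ℚ_∞, E[p^∞])` along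
`Φ_k = (ι_k)_* ∘ red_{p^k} : H¹(ℚ_n, T_pE) → H¹(ℚ_∞, E[p^∞])` (`ker Φ_k = p^k H¹(ℚ_n, T_pE)` by the Bockstein sequence and
`E(ℚ_∞)[p] = 0`; `p^k Φ_k = 0`), the bound is `B = dim_{𝔽_p} A[p]` — FINITE for `Sel^±(E/K_∞)` of a torsion datum with `μ = 0`
(`SignedTransportAtTwo.finite_torsionBy_signedSelmerInfty`) — by the three lemmas of THIS FILE:

* `natCard_torsionBy_pow_le` — for an abelian group `A` with `A[p]` finite: `A[p^k]` is finite and `#A[p^k] ≤ #A[p]^k`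
  (`0 → A[p] → A[p^{k+1}] —p→ A[p^k]`);
* `exists_artinRees_of_linearIndependent` — ARTIN–REES FOR LATTICES: `V` a `ℤ_p`-module without `p`-torsion and `p`-adically
  separated (`⋂ p^k V = 0`), `v_1, …, v_m ∈ V` linearly independent, `L = Σ ℤ_p v_i`: there is `c` with `L ∩ p^{k+c} V ⊆ p^k L` for
  every `k` (coefficientwise: `Σ a_i v_i ∈ p^{k+c} V ⇒ p^k ∣ a_i`). Proof: on the compact `ℤ_p^m` the sets
  `F_c = {a | Σ a_i v_i ∈ p^c V}` are open subgroups (they contain `p^c ℤ_p^m`), hence closed; the primitive vectors `P` (some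
  coordinate a unit) form a closed set; `⋂_c (P ∩ F_c) = ∅` by separatedness + independence, so some `P ∩ F_c = ∅` (Cantor), and a
  vector `a = p^j a₀` (`a₀` primitive) with `Σ a_i v_i ∈ p^{k+c} V`, `j < k`, would put `a₀ ∈ P ∩ F_c` (no `p`-torsion);
* `le_of_linearIndependent_of_maps` — THE COUNTING: with moreover additive maps `Φ_k : V → H` (`k ∈ ℕ`) such that
  `ker Φ_k ⊆ p^k V` and `p^k Φ_k = 0`, a subgroup `A ≤ H` with `A[p]` finite, `#A[p] ≤ p^d`, and `Φ_k(v_i) ∈ A` for all `i, k`: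
  then `m ≤ d` (`p^{km} = [ℤ_p^m : p^k ℤ_p^m] ≤ [ℤ_p^m : ker(Φ_{k+c} ∘ Σ)] = #im ≤ #A[p^{k+c}] ≤ p^{d(k+c)}` for all `k`).

HONEST FRAMING: closes nothing; the cohomological instantiation (`Φ_k`, `ker Φ_k = p^k H¹`, injectivity of
`H¹(ℚ_n, E[p^k]) → H¹(ℚ_∞, E[p^∞])`) is the next file; 23110 is NOT proved; BSD is not proved by any of this.
References: [NeukirchSchmidtWingberg2008] Ch. V §3 (compact `ℤ_p`-modules); [GreenbergLNM1716] §1 p. 60 (coranks), §3 Lemma 3.1;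
[Washington1997] §13.2; [Rubin2000] App. B §2.
-/

set_option autoImplicit false
-- D-0017: single-problem summit, so `Summit.BirchSwinnertonDyer.BirchSwinnertonDyer.…` repeats a namespace BY DESIGN.
set_option linter.dupNamespace false

noncomputable section

open scoped AddSubgroup

namespace Summit.BirchSwinnertonDyer.BirchSwinnertonDyer.Theorems.ResidualThetaLayer.TowerVanishing

/-! ## §1 Torsion growth: `#A[p^k] ≤ #A[p]^k` -/

section TorsionGrowth

variable {A : Type*} [AddCommGroup A] (p : ℕ)

/-- Multiplication by `p` maps `A[p^{k+1}]` to `A[p^k]`, with kernel inside `A[p]`. [folklore] -/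
theorem nsmul_mem_torsionBy_pow_of_mem_succ (k : ℕ) {a : A} (ha : a ∈ A[((p : ℤ) ^ (k + 1))]) :
    p • a ∈ A[((p : ℤ) ^ k)] := by
  rw [← Nat.cast_pow] at ha ⊢
  rw [AddSubgroup.torsionBy.nsmul_iff] at ha ⊢
  rwa [← mul_nsmul', ← pow_succ]

/-- **Torsion growth.** If `A[p]` is finite then every `A[p^k]` is finite and `#A[p^k] ≤ #A[p]^k`: the map `a ↦ p • a`,
`A[p^{k+1}] → A[p^k]`, has kernel `A[p]`, so `#A[p^{k+1}] ≤ #A[p] · #A[p^k]`. [cite: GreenbergLNM1716, §1 p. 60] [folklore] -/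
theorem finite_torsionBy_pow_and_natCard_le [Finite (A[(p : ℤ)])] (k : ℕ) :
    Finite (A[((p : ℤ) ^ k)]) ∧ Nat.card (A[((p : ℤ) ^ k)]) ≤ Nat.card (A[(p : ℤ)]) ^ k := by
  induction k with
  | zero =>
    have h0 : A[((p : ℤ) ^ 0)] = ⊥ := by
      ext a
      simp [AddSubgroup.torsionBy]
    rw [h0]
    exact ⟨inferInstance, by simp⟩
  | succ k ih =>
    obtain ⟨hfin, hcard⟩ := ih
    -- the map `p • : A[p^{k+1}] → A[p^k]`
    let f : A[((p : ℤ) ^ (k + 1))] →+ A[((p : ℤ) ^ k)] :=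
      { toFun := fun a ↦ ⟨p • (a : A), nsmul_mem_torsionBy_pow_of_mem_succ p k a.2⟩
        map_zero' := by ext; simp
        map_add' := fun a b ↦ by ext; simp }
    -- its kernel embeds in `A[p]`
    let g : f.ker →+ A[(p : ℤ)] :=
      { toFun := fun a ↦ ⟨((a : A[((p : ℤ) ^ (k + 1))]) : A), by
          have ha : f a = 0 := a.2
          have ha' : p • (((a : A[((p : ℤ) ^ (k + 1))]) : A)) = 0 := congrArg Subtype.val ha
          rw [← Nat.cast_smul_eq_nsmul ℤ] at ha'
          exact (Submodule.mem_torsionBy_iff _ _).mpr ha'⟩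
        map_zero' := by ext; rfl
        map_add' := fun a b ↦ by ext; rfl }
    have hg : Function.Injective g := fun a b h ↦ by
      apply Subtype.ext; apply Subtype.ext
      exact congrArg (fun x : A[(p : ℤ)] ↦ (x : A)) h
    haveI : Finite f.ker := Finite.of_injective g hg
    letI : Fintype f.ker := Fintype.ofFinite _
    letI : Fintype (A[((p : ℤ) ^ k)]) := Fintype.ofFinite _
    letI : Fintype (A[((p : ℤ) ^ (k + 1))]) := AddGroup.fintypeOfKerOfCodom f
    haveI : Finite f.range := inferInstance
    have hker : Nat.card f.ker ≤ Nat.card (A[(p : ℤ)]) := Nat.card_le_card_of_injective g hg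
    have hrange : Nat.card f.range ≤ Nat.card (A[((p : ℤ) ^ k)]) :=
      Nat.card_le_card_of_injective _ Subtype.val_injective
    -- `#A[p^{k+1}] = #range · #ker`
    have hmul : Nat.card (A[((p : ℤ) ^ (k + 1))]) = Nat.card f.range * Nat.card f.ker := by
      rw [← Nat.card_congr (QuotientAddGroup.quotientKerEquivRange f).toEquiv]
      exact AddSubgroup.card_eq_card_quotient_mul_card_addSubgroup _
    refine ⟨Finite.of_fintype _, ?_⟩
    rw [hmul]
    exact (Nat.mul_le_mul (hrange.trans hcard) hker).trans_eq (pow_succ _ _).symm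

/-- `A[p^k]` is finite when `A[p]` is. [folklore] -/
theorem finite_torsionBy_pow [Finite (A[(p : ℤ)])] (k : ℕ) : Finite (A[((p : ℤ) ^ k)]) :=
  (finite_torsionBy_pow_and_natCard_le p k).1

/-- **`#A[p^k] ≤ #A[p]^k`** when `A[p]` is finite. [cite: GreenbergLNM1716, §1 p. 60] [folklore] -/
theorem natCard_torsionBy_pow_le [Finite (A[(p : ℤ)])] (k : ℕ) :
    Nat.card (A[((p : ℤ) ^ k)]) ≤ Nat.card (A[(p : ℤ)]) ^ k :=
  (finite_torsionBy_pow_and_natCard_le p k).2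

end TorsionGrowth

/-! ## §2 Artin–Rees for lattices in a separated torsion-free `ℤ_p`-module (compactness of `ℤ_p^m`) -/

section ArtinRees

variable {p : ℕ} [Fact p.Prime]

/-- **Primitive decomposition in `ℤ_p^m`.** A non-zero vector `a ∈ ℤ_p^m` is `p^j • a₀` with some coordinate of `a₀` a unit
(`j` = the least valuation of a non-zero coordinate). [folklore] -/
theorem exists_eq_pow_smul_primitive {m : ℕ} (a : Fin m → ℤ_[p]) (ha : a ≠ 0) :
    ∃ (j : ℕ) (a₀ : Fin m → ℤ_[p]), a = (p : ℤ_[p]) ^ j • a₀ ∧ ∃ i, ‖a₀ i‖ = 1 := by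
  classical
  have hp : (p : ℤ_[p]) ≠ 0 := by exact_mod_cast (Fact.out : p.Prime).ne_zero
  obtain ⟨i₁, hi₁⟩ : ∃ i, a i ≠ 0 := by
    by_contra h
    push Not at h
    exact ha (funext h)
  let s : Finset (Fin m) := Finset.univ.filter fun i ↦ a i ≠ 0
  have hs : s.Nonempty := ⟨i₁, by simp [s, hi₁]⟩
  obtain ⟨i₀, hi₀, hmin⟩ := s.exists_min_image (fun i ↦ (a i).valuation) hs
  have hi₀' : a i₀ ≠ 0 := by simpa [s] using hi₀
  -- every coordinate is divisible by `p^j`, `j = val (a i₀)`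
  have hdvd : ∀ i, (p : ℤ_[p]) ^ (a i₀).valuation ∣ a i := by
    intro i
    by_cases hi : a i = 0
    · rw [hi]; exact dvd_zero _
    · have hle : (a i₀).valuation ≤ (a i).valuation := hmin i (by simp [s, hi])
      exact Ideal.mem_span_singleton.mp ((PadicInt.mem_span_pow_iff_le_valuation (a i) hi _).mpr hle)
  choose b hb using hdvd
  refine ⟨(a i₀).valuation, b, funext fun i ↦ ?_, i₀, ?_⟩
  · rw [Pi.smul_apply, smul_eq_mul]; exact hb i
  · have hspec := PadicInt.unitCoeff_spec hi₀'
    have h1 : (p : ℤ_[p]) ^ (a i₀).valuation * b i₀ =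
        (p : ℤ_[p]) ^ (a i₀).valuation * (PadicInt.unitCoeff hi₀' : ℤ_[p]) := by
      rw [← hb i₀, mul_comm ((p : ℤ_[p]) ^ _)]
      exact hspec
    rw [mul_left_cancel₀ (pow_ne_zero _ hp) h1]
    exact PadicInt.isUnit_iff.mp (Units.isUnit _)

variable {V : Type*} [AddCommGroup V] [Module ℤ_[p] V]

/-- **Artin–Rees for lattices.** Let `V` be a `ℤ_p`-module without `p`-torsion and `p`-adically separated (`⋂_k p^k V = 0`), and
`v_1, …, v_m ∈ V` linearly independent over `ℤ_p`, spanning the lattice `L`. Then there is `c` such that for every `k`: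
`Σ a_i v_i ∈ p^{k+c} V ⟹ p^k ∣ a_i` for all `i` — i.e. `L ∩ p^{k+c} V ⊆ p^k L` (the `p`-adic topology of `V` induces the `p`-adic
topology of `L ≅ ℤ_p^m`). Compactness: in `ℤ_p^m` the subgroups `F_c = {a | Σ a_i v_i ∈ p^c V}` contain `p^c ℤ_p^m`, so they are
open hence closed; the primitive vectors form a closed set `P`; `⋂_c (P ∩ F_c) = ∅` (separatedness + independence), so some
`P ∩ F_c` is empty (Cantor's intersection theorem); and a vector `p^j • a₀`, `a₀ ∈ P`, `j < k`, in `F_{k+c}` would give `a₀ ∈ F_c`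
(no `p`-torsion). [cite: NeukirchSchmidtWingberg2008, Ch. V §3] [folklore] -/
theorem exists_artinRees_of_linearIndependent
    (htf : ∀ (k : ℕ) (v : V), ((p : ℤ_[p]) ^ k) • v = 0 → v = 0)
    (hsep : ∀ v : V, (∀ k : ℕ, ∃ w : V, ((p : ℤ_[p]) ^ k) • w = v) → v = 0)
    {m : ℕ} (v : Fin m → V) (hv : LinearIndependent ℤ_[p] v) :
    ∃ c : ℕ, ∀ (k : ℕ) (a : Fin m → ℤ_[p]),
      (∃ w : V, ((p : ℤ_[p]) ^ (k + c)) • w = ∑ i, a i • v i) → ∀ i, (p : ℤ_[p]) ^ k ∣ a i := by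
  classical
  have hp : (p : ℤ_[p]) ≠ 0 := by exact_mod_cast (Fact.out : p.Prime).ne_zero
  have hp1 : (1 : ℝ) < p := by exact_mod_cast (Fact.out : p.Prime).one_lt
  -- the combination map and its homogeneity
  have hsmul : ∀ (r : ℤ_[p]) (a : Fin m → ℤ_[p]), ∑ i, (r • a) i • v i = r • ∑ i, a i • v i := fun r a ↦ by
    rw [Finset.smul_sum]
    exact Finset.sum_congr rfl fun i _ ↦ by rw [Pi.smul_apply, smul_eq_mul, mul_smul]
  -- the subgroups `F c = {a | Σ a_i v_i ∈ p^c V}`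
  let F : ℕ → AddSubgroup (Fin m → ℤ_[p]) := fun c ↦
    { carrier := {a | ∃ w : V, ((p : ℤ_[p]) ^ c) • w = ∑ i, a i • v i}
      zero_mem' := ⟨0, by simp⟩
      add_mem' := by
        rintro a b ⟨w, hw⟩ ⟨w', hw'⟩
        exact ⟨w + w', by simp only [smul_add, hw, hw', Pi.add_apply, add_smul, Finset.sum_add_distrib]⟩
      neg_mem' := by
        rintro a ⟨w, hw⟩
        exact ⟨-w, by simp only [smul_neg, hw, Pi.neg_apply, neg_smul, Finset.sum_neg_distrib]⟩ }
  have hFmem : ∀ (c : ℕ) (a : Fin m → ℤ_[p]),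
      a ∈ F c ↔ ∃ w : V, ((p : ℤ_[p]) ^ c) • w = ∑ i, a i • v i := fun c a ↦ Iff.rfl
  have hFanti : ∀ (c : ℕ) (a : Fin m → ℤ_[p]), a ∈ F (c + 1) → a ∈ F c := by
    rintro c a ⟨w, hw⟩
    exact ⟨(p : ℤ_[p]) • w, by rw [← hw, pow_succ, mul_smul]⟩
  have hFanti' : ∀ (c d : ℕ) (a : Fin m → ℤ_[p]), c ≤ d → a ∈ F d → a ∈ F c := by
    intro c d a hcd ha
    obtain ⟨e, rfl⟩ := Nat.exists_eq_add_of_le hcd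
    induction e with
    | zero => exact ha
    | succ e ih => exact ih (Nat.le_add_right c e) (hFanti (c + e) a ha)
  -- `F c` contains the open box `{a | ∀ i, ‖a i‖ ≤ p^{-c}}`, hence is open, hence closed
  have hFclosed : ∀ c, IsClosed (F c : Set (Fin m → ℤ_[p])) := by
    intro c
    apply AddSubgroup.isClosed_of_isOpen
    apply AddSubgroup.isOpen_of_mem_nhds (F c) (g := 0)
    have hU : IsOpen {a : Fin m → ℤ_[p] | ∀ i, ‖a i‖ < (p : ℝ) ^ (-(c : ℤ) + 1)} := by
      have : {a : Fin m → ℤ_[p] | ∀ i, ‖a i‖ < (p : ℝ) ^ (-(c : ℤ) + 1)} =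
          Set.pi Set.univ fun _ ↦ Metric.ball (0 : ℤ_[p]) ((p : ℝ) ^ (-(c : ℤ) + 1)) := by
        ext a; simp [Set.mem_pi]
      rw [this]
      exact isOpen_set_pi Set.finite_univ fun _ _ ↦ Metric.isOpen_ball
    refine mem_nhds_iff.mpr ⟨_, fun a ha ↦ ?_, hU, fun i ↦ by
      simp only [Pi.zero_apply, norm_zero]; positivity⟩
    -- `‖a i‖ < p^{-c+1}` means `p^c ∣ a i`
    have hdvd : ∀ i, (p : ℤ_[p]) ^ c ∣ a i := fun i ↦
      Ideal.mem_span_singleton.mp ((PadicInt.norm_le_pow_iff_mem_span_pow (a i) c).mp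
        ((PadicInt.norm_le_pow_iff_norm_lt_pow_add_one (a i) (-(c : ℤ))).mpr (ha i)))
    choose b hb using hdvd
    refine (hFmem c a).mpr ⟨∑ i, b i • v i, ?_⟩
    rw [Finset.smul_sum]
    exact Finset.sum_congr rfl fun i _ ↦ by rw [hb i, mul_smul]
  -- the primitive vectors: a closed set
  let P : Set (Fin m → ℤ_[p]) := {a | ∃ i, ‖a i‖ = 1}
  have hPclosed : IsClosed P := by
    have : P = ⋃ i, {a : Fin m → ℤ_[p] | ‖a i‖ = 1} := by ext a; simp [P]
    rw [this]
    exact isClosed_iUnion_of_finite fun i ↦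
      isClosed_eq (continuous_norm.comp (continuous_apply i)) continuous_const
  -- Cantor: some `P ∩ F c` is empty
  have hempty : ∃ c, ∀ a, a ∈ P → a ∉ F c := by
    by_contra H
    push Not at H
    have hne : ∀ c, (P ∩ (F c : Set (Fin m → ℤ_[p]))).Nonempty := fun c ↦ by
      obtain ⟨a, haP, haF⟩ := H c
      exact ⟨a, haP, haF⟩
    obtain ⟨a, ha⟩ := IsCompact.nonempty_iInter_of_sequence_nonempty_isCompact_isClosed
      (fun c ↦ P ∩ (F c : Set (Fin m → ℤ_[p])))
      (fun c x hx ↦ ⟨hx.1, hFanti c x hx.2⟩) hne ((hPclosed.inter (hFclosed 0)).isCompact)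
      (fun c ↦ hPclosed.inter (hFclosed c))
    rw [Set.mem_iInter] at ha
    -- `Σ a_i v_i ∈ ⋂ p^c V = 0`, so `a = 0` — but `a` is primitive
    have h0 : ∑ i, a i • v i = 0 := hsep _ fun c ↦ (ha c).2
    have ha0 : ∀ i, a i = 0 := Fintype.linearIndependent_iff.mp hv a h0
    obtain ⟨i, hi⟩ := (ha 0).1
    rw [ha0 i, norm_zero] at hi
    exact zero_ne_one hi
  obtain ⟨c, hc⟩ := hempty
  refine ⟨c, fun k a ha i ↦ ?_⟩
  by_cases ha0 : a = 0
  · rw [ha0]; exact dvd_zero _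
  obtain ⟨j, a₀, rfl, hprim⟩ := exists_eq_pow_smul_primitive a ha0
  by_cases hjk : k ≤ j
  · obtain ⟨e, rfl⟩ := Nat.exists_eq_add_of_le hjk
    exact ⟨(p : ℤ_[p]) ^ e * a₀ i, by rw [Pi.smul_apply, smul_eq_mul, pow_add, mul_assoc]⟩
  · -- `j < k`: then `a₀ ∈ P ∩ F c`, impossible
    exfalso
    push Not at hjk
    obtain ⟨e, hke⟩ : ∃ e, k + c = j + (c + (e + 1)) := ⟨k - j - 1, by omega⟩
    obtain ⟨w, hw⟩ := ha
    rw [hsmul, hke, pow_add, mul_smul] at hw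
    -- cancel `p^j` (no `p`-torsion)
    have h1 : ∑ i, a₀ i • v i = (p : ℤ_[p]) ^ (c + (e + 1)) • w := by
      rw [← sub_eq_zero]
      apply htf j
      rw [smul_sub, hw, sub_self]
    refine hc a₀ hprim ((hFmem c a₀).mpr ⟨(p : ℤ_[p]) ^ (e + 1) • w, ?_⟩)
    rw [h1, ← mul_smul, ← pow_add]

end ArtinRees

/-! ## §3 The counting: the rank of a lattice reducing into `A` is at most `dim A[p]` -/

section Counting

variable {p : ℕ} [Fact p.Prime] {V : Type*} [AddCommGroup V] [Module ℤ_[p] V] {H : Type*} [AddCommGroup H]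

/-- `[ℤ_p^m : p^k ℤ_p^m] = p^{km}`: the subgroup `{a | ∀ i, p^k ∣ a i}` of `ℤ_p^m` is the kernel of the surjection onto
`(ℤ/p^k)^m`. [folklore] -/
theorem index_setOf_forall_pow_dvd (m k : ℕ) (U : AddSubgroup (Fin m → ℤ_[p]))
    (hU : ∀ a, a ∈ U ↔ ∀ i, (p : ℤ_[p]) ^ k ∣ a i) : U.index = (p ^ k) ^ m := by
  classical
  haveI : NeZero (p ^ k) := ⟨pow_ne_zero _ (Fact.out : p.Prime).ne_zero⟩
  -- the reduction `ℤ_p^m → (ℤ/p^k)^m`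
  let π : (Fin m → ℤ_[p]) →+ (Fin m → ZMod (p ^ k)) :=
    { toFun := fun a i ↦ PadicInt.toZModPow k (a i)
      map_zero' := funext fun i ↦ by simp
      map_add' := fun a b ↦ funext fun i ↦ by simp }
  have hker : π.ker = U := by
    ext a
    rw [AddMonoidHom.mem_ker, hU]
    constructor
    · intro h i
      have hi : PadicInt.toZModPow k (a i) = 0 := congr_fun h i
      exact Ideal.mem_span_singleton.mp ((PadicInt.ker_toZModPow k).le hi)
    · intro h
      funext i
      have hi : a i ∈ RingHom.ker (PadicInt.toZModPow k : ℤ_[p] →+* ZMod (p ^ k)) := by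
        rw [PadicInt.ker_toZModPow]; exact Ideal.mem_span_singleton.mpr (h i)
      exact hi
  have hsurj : Function.Surjective π := fun r ↦
    ⟨fun i ↦ ((r i).val : ℤ_[p]), funext fun i ↦ by simp [π]⟩
  rw [← hker, AddSubgroup.index_ker, AddMonoidHom.range_eq_top.mpr hsurj, AddSubgroup.card_top, Nat.card_fun,
    Nat.card_zmod, Nat.card_eq_fintype_card, Fintype.card_fin]

/-- **The counting (rank of a lattice that reduces into `A` ≤ `dim A[p]`).** Let `V` be a `ℤ_p`-module without `p`-torsion and
`p`-adically separated, `Φ_k : V → H` (`k ∈ ℕ`) additive maps into an abelian group with `ker Φ_k ⊆ p^k V` and `p^k Φ_k = 0`, and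
`A ≤ H` a subgroup with `A[p]` finite, `#A[p] ≤ p^d`. If `v_1, …, v_m ∈ V` are `ℤ_p`-linearly independent and the whole lattice
`L = Σ ℤ_p v_i` is mapped into `A` by every `Φ_k`, then `m ≤ d`: with `c` from Artin–Rees, `p^{km} = [ℤ_p^m : p^k ℤ_p^m] ≤
[ℤ_p^m : ker(Φ_{k+c} ∘ Σ)] = #im(Φ_{k+c} ∘ Σ) ≤ #A[p^{k+c}] ≤ p^{d(k+c)}` for every `k`. (Application: `V = H¹(ℚ_n, T_pE)`,
`Φ_k = (ι_k)_* ∘ red_{p^k}`, `A = Sel⁺(E/ℚ_∞)`: the compact form of input (Λ3).) [cite: GreenbergLNM1716, §1 p. 60 and §3 Lemma 3.1]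
[cite: NeukirchSchmidtWingberg2008, Ch. V §3] -/
theorem le_of_linearIndependent_of_maps
    (htf : ∀ (k : ℕ) (v : V), ((p : ℤ_[p]) ^ k) • v = 0 → v = 0)
    (hsep : ∀ v : V, (∀ k : ℕ, ∃ w : V, ((p : ℤ_[p]) ^ k) • w = v) → v = 0)
    {m : ℕ} (v : Fin m → V) (hv : LinearIndependent ℤ_[p] v)
    (A : AddSubgroup H) [Finite ((↥A)[(p : ℤ)])] (d : ℕ) (hd : Nat.card ((↥A)[(p : ℤ)]) ≤ p ^ d)
    (Φ : ℕ → V →+ H)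
    (hker : ∀ (k : ℕ) (x : V), Φ k x = 0 → ∃ w : V, ((p : ℤ_[p]) ^ k) • w = x)
    (htor : ∀ (k : ℕ) (x : V), p ^ k • Φ k x = 0)
    (hLA : ∀ (k : ℕ) (a : Fin m → ℤ_[p]), Φ k (∑ i, a i • v i) ∈ A) :
    m ≤ d := by
  classical
  have hP : p.Prime := Fact.out
  have hp1 : 1 < p := hP.one_lt
  obtain ⟨c, hc⟩ := exists_artinRees_of_linearIndependent htf hsep v hv
  -- for every `k`: `p^{km} ≤ p^{d(k+c)}`
  have hk : ∀ k : ℕ, p ^ (k * m) ≤ p ^ (d * (k + c)) := by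
    intro k
    -- `g = Φ_{k+c} ∘ Σ : ℤ_p^m → H`
    let g : (Fin m → ℤ_[p]) →+ H :=
      { toFun := fun a ↦ Φ (k + c) (∑ i, a i • v i)
        map_zero' := by simp
        map_add' := fun a b ↦ by
          rw [← map_add]; congr 1
          simp only [Pi.add_apply, add_smul, Finset.sum_add_distrib] }
    -- its image lies in `A[p^{k+c}]`
    haveI : Finite ((↥A)[((p : ℤ) ^ (k + c))]) := finite_torsionBy_pow p (k + c)
    let ι : g.range → (↥A)[((p : ℤ) ^ (k + c))] := fun x ↦
      ⟨⟨(x : H), by obtain ⟨a, ha⟩ := x.2; rw [← ha]; exact hLA (k + c) a⟩, by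
        rw [← Nat.cast_pow, AddSubgroup.torsionBy.nsmul_iff]
        apply Subtype.ext
        obtain ⟨a, ha⟩ := x.2
        change p ^ (k + c) • (x : H) = 0
        rw [← ha]
        exact htor (k + c) _⟩
    have hι : Function.Injective ι := by
      intro x y h
      apply Subtype.ext
      have h' := congrArg (fun z : (↥A)[((p : ℤ) ^ (k + c))] ↦ ((z : ↥A) : H)) h
      exact h'
    have hrange : Nat.card g.range ≤ p ^ (d * (k + c)) := by
      haveI : Finite g.range := Finite.of_injective ι hι
      calc Nat.card g.range ≤ Nat.card ((↥A)[((p : ℤ) ^ (k + c))]) := Nat.card_le_card_of_injective ι hι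
        _ ≤ Nat.card ((↥A)[(p : ℤ)]) ^ (k + c) := natCard_torsionBy_pow_le p (k + c)
        _ ≤ (p ^ d) ^ (k + c) := Nat.pow_le_pow_left hd _
        _ = p ^ (d * (k + c)) := by rw [← pow_mul]
    -- its kernel lies in `p^k ℤ_p^m` (Artin–Rees)
    let U : AddSubgroup (Fin m → ℤ_[p]) :=
      { carrier := {a | ∀ i, (p : ℤ_[p]) ^ k ∣ a i}
        zero_mem' := fun i ↦ by simp
        add_mem' := fun {a b} ha hb i ↦ by rw [Pi.add_apply]; exact dvd_add (ha i) (hb i)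
        neg_mem' := fun {a} ha i ↦ by rw [Pi.neg_apply]; exact (dvd_neg).mpr (ha i) }
    have hkerU : g.ker ≤ U := fun a ha i ↦ hc k a (hker (k + c) _ ha) i
    have hUindex : U.index = (p ^ k) ^ m := index_setOf_forall_pow_dvd m k U fun a ↦ Iff.rfl
    haveI : Finite g.range := Finite.of_injective ι hι
    have hgindex : g.ker.index = Nat.card g.range := AddSubgroup.index_ker g
    have hne : g.ker.index ≠ 0 := by rw [hgindex]; exact Nat.card_pos.ne'
    have hdvd : U.index ∣ g.ker.index := AddSubgroup.index_dvd_of_le hkerU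
    calc p ^ (k * m) = U.index := by rw [hUindex, ← pow_mul]
      _ ≤ g.ker.index := Nat.le_of_dvd (Nat.pos_of_ne_zero hne) hdvd
      _ = Nat.card g.range := hgindex
      _ ≤ p ^ (d * (k + c)) := hrange
  -- hence `km ≤ d(k+c)` for all `k`, so `m ≤ d`
  have hk' : ∀ k : ℕ, k * m ≤ d * (k + c) := fun k ↦ (Nat.pow_le_pow_iff_right hp1).mp (hk k)
  by_contra hmd
  push Not at hmd
  have h1 := hk' (d * c + 1)
  have h2 : (d * c + 1) * (d + 1) ≤ (d * c + 1) * m := Nat.mul_le_mul_left _ hmd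
  nlinarith [h1, h2]

end Counting



end Summit.BirchSwinnertonDyer.BirchSwinnertonDyer.Theorems.ResidualThetaLayer.TowerVanishing

end
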